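import Summits.SmoothPoincare4.SmoothPoincare4.Theses.CongruenceShadows
import Summits.SmoothPoincare4.SmoothPoincare4.Theorems.CongruenceShadowsShadowApproximationStubGenusThreeNielsen
import Summits.SmoothPoincare4.SmoothPoincare4.Theorems.CongruenceShadowsShadowApproximationStubHallClosure
import Summits.SmoothPoincare4.SmoothPoincare4.Theorems.CongruenceShadowsShadowApproximationStubRebasing
import HarnessLib
import HarnessLib.Audit

/-!
# Line `free-shadow-tsystem` for crux `CongruenceShadows.ShadowApproximation` (stmt-SmoothPoincare4-14595)

LEAD INTEGRATION (prover-line-stmt-SmoothPoincare4-14595-0, wave A, 2026-08-16): stubs 1, 3, 4, 5 are LANDED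
(`stub_genusThreeNielsen` p92539, `stub_hallClosure` p92799, `stub_rebasing` p93770, `stub_handlebodyRealisation`
p105838; Literature by-products: M. Hall `FreeGroupSubgroupSeparable.lean` p92059, Nielsen generating tuples p92232/p93213,
`FreeGroupRebasing.lean` p93592, `HandlebodyGroupRealisation.lean` p104359 etc.); stubs 1, 3, 4 are imported here, stub 5 is
kept as a sorry in this INTERIM copy only because its module was not yet built on the check farm (the lead folder copy
work/ShadowApproximationA.lean imports all four). Genuinely open: `stub_denseFactor` (⟺ the Nielsen level at m ≥ 1) and
`stub_twistLevel` (= the crux at m = 0 verbatim). Verdict: Lines/free-shadow-tsystem-dead.md.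

Skeleton (crux-plan, round 1, idea `free-shadow-tsystem`, triage r1-1: pass + sharpenings):
**the H₀-relative T-system of a trisection of the trivial group, and Luft's sequence
`1 → Tw(H₀) → Stab(N₀) → Aut π₁(H₀) → 1`.**

Notation (all objects are existing declarations of `Literature.Topology.FourManifolds` and of the
route file): `S = SurfaceGroup (3+3m)`, `N = s4Kernels.stabilizeIter m` (the standard `(3+3m; m+1)`
triple of `S⁴`), `F = S ⧸ N 0` (= `π₁(H₀)`, free of rank `3(m+1)` on the images of
`b_{3j}, b_{3j+1}, a_{3j+2}`), `π = QuotientGroup.mk' (N 0)`, `Ū = π(N 1)`, `V̄_N = π(N 2)`,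
`V̄_K = π(K 2)`, `B_V = π(closure {b_{3j}, a_{3j+2} : j ≤ m})` (a rank-`2(m+1)` free factor of `F`
with normal closure `V̄_N` and `B_V ⊔ Ū = ⊤`). The pair `(Ū, V̄_K)` is the kernel pair of the
H₀-relative epimorphism `Φ_K : F ↠ F/Ū × F/V̄_K = F_k × F_k` of the card; `π₁ = 1` (the `triple`
field of `IsGroupTrisection`) is its surjectivity `Ū ⊔ V̄_K = ⊤`.

Chain (each arrow is a registered stub; the glue between them is proved in this file):

  crux hypotheses for `K` (group trisection of `{1}`, all three pairs standard `hW`, all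
  characteristic finite shadows standard `hS`)
  —[proved here: slot normalisation by `hW 0 1` and `Aut S`-invariance of every hypothesis and of
     the conclusion (`isGroupTrisection_map`, `pairs_transport`, `shadows_transport`,
     `iso_transport`)]→ WLOG `K 0 = N 0`, `K 1 = N 1`
  —[NIELSEN LEVEL, in the free group `F`:
     `m = 0`: `stub_genusThreeNielsen` (vacuous level: `F₃ ↠ ℤ × ℤ` is unique, GL₃(ℤ) column
       reduction; provable now, no shadow hypothesis);
     `m ≥ 1`: `stub_denseFactor` (LOAD-BEARING: shadows ⟹ a free factor `θ₀(B_V)` with normal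
       closure `V̄_K` whose image in `F/Ū ≅ F_{m+1}` is profinitely dense)
       → `stub_hallClosure` (M. Hall 1949: a finitely generated profinitely dense subgroup of a
       free group is everything — the profinite-to-discrete step)
       → `stub_rebasing` (T⁺ ⟹ Nielsen-standard: re-base the complement along `A`, the triage
       sharpening)]→ `∃ θ ∈ Aut F, θ(Ū) = Ū, θ(V̄_N) = V̄_K`
  —[`stub_handlebodyRealisation` (Zieschang–Luft–McMillan: `Stab_{Aut S}(N 0) ↠ Aut (S ⧸ N 0)`)]→
     `β ∈ Aut S`, `β(N 0) = N 0`, `β̄ = θ`; replacing `K` by `β⁻¹K` (proved here: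
     `sup_eq_of_quotient`) puts `K` in the LUFT FIBRE: `K 0 = N 0`, `K i ⊔ N 0 = N i ⊔ N 0`
  —[TWIST LEVEL `stub_twistLevel` (the honest residual = the crux on the Luft fibre; at `m = 0`
     it is the whole crux)]→ `Iso N K`.

`ShadowApproximation_of : …CongruenceShadows.ShadowApproximation` is proved below from the six
stubs with NO hypotheses (the crux carries `hW`, `hS` itself); sorries only inside `stub_*`.

Disproof.lean: none exists for this crux on this hub (payload `disproof_path` absent; `ledger crux
ls` shows no Disproof.lean, 2026-08-15). Honoured instead (refuter crux-attack Evidence.lean,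
item note 19:47Z): `IsGroupTrisection` is load-bearing — it is an explicit hypothesis of
`stub_denseFactor` / `stub_twistLevel` / `stub_genusThreeNielsen` (its `triple` field is the
surjectivity `Ū ⊔ V̄_K = ⊤` without which `stub_denseFactor` is false: Meier's spun-lens-space
triples); the pair normalisations `hW` are NOT dropped (triage r1-1 sharpening) but transported to
every stub; `ledger negatives --problem SmoothPoincare4` = 0, so no stub restates a refuted
statement.
-/

noncomputable section

set_option linter.dupNamespace false

open Literature.Topology.FourManifolds

namespace Summit.SmoothPoincare4.SmoothPoincare4.Cruxes.ShadowApproximation.FreeShadowTsystem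

/-! ## 0. Sorry-free conventions and transport lemmas -/

/-- The standard kernels `s4Kernels.stabilizeIter m i` are normal closures, hence normal; this
instance makes `SurfaceGroup (3+3m) ⧸ s4Kernels.stabilizeIter m 0` a group (`= π₁(H₀)`). -/
instance stdKernel_normal (m : ℕ) (i : Fin 3) : (s4Kernels.stabilizeIter m i).Normal := by
  cases m with
  | zero =>
    show (s4Kernels i).Normal
    rw [s4Kernels_eq]
    infer_instance
  | succ n =>
    show ((s4Kernels.stabilizeIter n).stabilize i).Normal
    rw [TrisectionKernels.stabilize_apply]
    infer_instance

section transport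

variable {G : Type*} [Group G]

/-- `H ↦ H.map` along a composite of automorphisms. -/
theorem map_trans (e₁ e₂ : G ≃* G) (H : Subgroup G) :
    H.map (e₁.trans e₂).toMonoidHom = (H.map e₁.toMonoidHom).map e₂.toMonoidHom := by
  rw [Subgroup.map_map]
  rfl

/-- `e⁻¹` undoes `e` on subgroups. -/
theorem map_map_symm (e : G ≃* G) (H : Subgroup G) :
    (H.map e.toMonoidHom).map e.symm.toMonoidHom = H := by
  ext x
  simp

/-- `e` undoes `e⁻¹` on subgroups. -/
theorem map_symm_map (e : G ≃* G) (H : Subgroup G) :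
    (H.map e.symm.toMonoidHom).map e.toMonoidHom = H := by
  ext x
  simp

/-- If `e(H) = K` then `e⁻¹(K) = H`. -/
theorem map_symm_of_map (e : G ≃* G) {H K : Subgroup G} (h : H.map e.toMonoidHom = K) :
    K.map e.symm.toMonoidHom = H := by
  rw [← h, map_map_symm]

end transport

variable {g : ℕ}

/-- **`Aut S_g`-invariance of the group-trisection property** (Abrams–Gay–Kirby: isomorphic kernel
triples have isomorphic cubes of quotients): if `K` is a `(g,k)` group trisection of `G`, so is
`α • K = (α(K₀), α(K₁), α(K₂))` for every automorphism `α` of `S_g`. Each of the seven quotients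
of `α • K` is isomorphic to the corresponding quotient of `K` via `QuotientGroup.congr`. -/
theorem isGroupTrisection_map {k : ℕ} {G : Type*} [Group G] {K : TrisectionKernels g}
    (hK : IsGroupTrisection g k G K) (α : SurfaceGroup g ≃* SurfaceGroup g) :
    IsGroupTrisection g k G (fun i => (K i).map α.toMonoidHom) := by
  have hsurj : Function.Surjective (α : SurfaceGroup g →* SurfaceGroup g) := α.surjective
  have himg : ∀ i, ((K i).map α.toMonoidHom : Set (SurfaceGroup g)) = α '' (K i) := fun i =>
    Subgroup.coe_map _ _
  have hnc : ∀ s : Set (SurfaceGroup g),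
      (Subgroup.normalClosure s).map (α : SurfaceGroup g →* SurfaceGroup g) =
        Subgroup.normalClosure (α '' s) := fun s =>
    Subgroup.map_normalClosure s _ hsurj
  refine ⟨fun i => (hK.normal i).map α.toMonoidHom α.surjective, fun i => ?_, fun i j hij => ?_, ?_⟩
  · refine (hK.free_quotient i).of_mulEquiv (QuotientGroup.congr _ _ α ?_)
    simp only [hnc, himg]
  · refine (hK.free_pairQuotient i j hij).of_mulEquiv (QuotientGroup.congr _ _ α ?_)
    simp only [hnc, himg, Set.image_union]
  · obtain ⟨e⟩ := hK.triple
    refine ⟨(QuotientGroup.congr _ _ α ?_).symm.trans e⟩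
    simp only [hnc, himg, Set.image_iUnion]

variable {m : ℕ}

/-- Transport of the pair-normalisation hypothesis `hW` of the crux along `γ ∈ Aut S`. -/
theorem pairs_transport (γ : SurfaceGroup (3 + 3 * m) ≃* SurfaceGroup (3 + 3 * m))
    {K : TrisectionKernels (3 + 3 * m)}
    (hW : ∀ i j : Fin 3, i ≠ j → ∃ α : SurfaceGroup (3 + 3 * m) ≃* SurfaceGroup (3 + 3 * m),
      (s4Kernels.stabilizeIter m i).map α.toMonoidHom = K i ∧
        (s4Kernels.stabilizeIter m j).map α.toMonoidHom = K j) :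
    ∀ i j : Fin 3, i ≠ j → ∃ α : SurfaceGroup (3 + 3 * m) ≃* SurfaceGroup (3 + 3 * m),
      (s4Kernels.stabilizeIter m i).map α.toMonoidHom = (K i).map γ.toMonoidHom ∧
        (s4Kernels.stabilizeIter m j).map α.toMonoidHom = (K j).map γ.toMonoidHom := by
  intro i j hij
  obtain ⟨α, hi, hj⟩ := hW i j hij
  exact ⟨α.trans γ, by rw [map_trans, hi], by rw [map_trans, hj]⟩

/-- Transport of the standard-shadows hypothesis `hS` of the crux along `γ ∈ Aut S`
(characteristic subgroups are `Aut S`-invariant). -/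
theorem shadows_transport (γ : SurfaceGroup (3 + 3 * m) ≃* SurfaceGroup (3 + 3 * m))
    {K : TrisectionKernels (3 + 3 * m)}
    (hS : ∀ M : Subgroup (SurfaceGroup (3 + 3 * m)), M.Characteristic → M.FiniteIndex →
      ∃ ψ : SurfaceGroup (3 + 3 * m) ≃* SurfaceGroup (3 + 3 * m), ∀ i : Fin 3,
        (s4Kernels.stabilizeIter m i ⊔ M).map ψ.toMonoidHom = K i ⊔ M) :
    ∀ M : Subgroup (SurfaceGroup (3 + 3 * m)), M.Characteristic → M.FiniteIndex →
      ∃ ψ : SurfaceGroup (3 + 3 * m) ≃* SurfaceGroup (3 + 3 * m), ∀ i : Fin 3,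
        (s4Kernels.stabilizeIter m i ⊔ M).map ψ.toMonoidHom = (K i).map γ.toMonoidHom ⊔ M := by
  intro M hM hMf
  obtain ⟨ψ, hψ⟩ := hS M hM hMf
  refine ⟨ψ.trans γ, fun i => ?_⟩
  rw [map_trans, hψ i, Subgroup.map_sup, (Subgroup.characteristic_iff_map_eq.mp hM) γ]

/-- Transport of the conclusion: `N ≅ γ⁻¹ • K` implies `N ≅ K`. -/
theorem iso_transport (γ : SurfaceGroup (3 + 3 * m) ≃* SurfaceGroup (3 + 3 * m))
    {K : TrisectionKernels (3 + 3 * m)}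
    (h : TrisectionKernels.Iso (s4Kernels.stabilizeIter m) (fun i => (K i).map γ.symm.toMonoidHom)) :
    TrisectionKernels.Iso (s4Kernels.stabilizeIter m) K := by
  obtain ⟨β, hβ⟩ := h
  refine ⟨β.trans γ, fun i => ?_⟩
  rw [map_trans, hβ i]
  exact map_symm_map γ (K i)

/-- **Into the Luft fibre.** If `β ∈ Aut S` stabilises `N 0` and induces `θ` on `F = S ⧸ N 0`, and
`θ` carries `π(A)` to `π(B)`, then `β⁻¹(B) ≡ A (mod N 0)`, i.e. `β⁻¹(B) ⊔ N 0 = A ⊔ N 0`. -/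
theorem sup_eq_of_quotient (β : SurfaceGroup (3 + 3 * m) ≃* SurfaceGroup (3 + 3 * m))
    (θ : (SurfaceGroup (3 + 3 * m) ⧸ s4Kernels.stabilizeIter m 0) ≃*
      (SurfaceGroup (3 + 3 * m) ⧸ s4Kernels.stabilizeIter m 0))
    (hβ0 : (s4Kernels.stabilizeIter m 0).map β.toMonoidHom = s4Kernels.stabilizeIter m 0)
    (hβ : ∀ s : SurfaceGroup (3 + 3 * m),
      QuotientGroup.mk' (s4Kernels.stabilizeIter m 0) (β s) =
        θ (QuotientGroup.mk' (s4Kernels.stabilizeIter m 0) s))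
    {A B : Subgroup (SurfaceGroup (3 + 3 * m))}
    (h : (A.map (QuotientGroup.mk' (s4Kernels.stabilizeIter m 0))).map θ.toMonoidHom =
      B.map (QuotientGroup.mk' (s4Kernels.stabilizeIter m 0))) :
    B.map β.symm.toMonoidHom ⊔ s4Kernels.stabilizeIter m 0 = A ⊔ s4Kernels.stabilizeIter m 0 := by
  have hcomp : (QuotientGroup.mk' (s4Kernels.stabilizeIter m 0)).comp β.toMonoidHom =
      θ.toMonoidHom.comp (QuotientGroup.mk' (s4Kernels.stabilizeIter m 0)) :=
    MonoidHom.ext hβ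
  have h1 : (A.map β.toMonoidHom).map (QuotientGroup.mk' (s4Kernels.stabilizeIter m 0)) =
      B.map (QuotientGroup.mk' (s4Kernels.stabilizeIter m 0)) := by
    rw [Subgroup.map_map, hcomp, ← Subgroup.map_map, h]
  have h2 : A.map β.toMonoidHom ⊔ s4Kernels.stabilizeIter m 0 = B ⊔ s4Kernels.stabilizeIter m 0 := by
    have := congrArg (Subgroup.comap (QuotientGroup.mk' (s4Kernels.stabilizeIter m 0))) h1
    simpa only [Subgroup.comap_map_eq, QuotientGroup.ker_mk'] using this
  have h3 := congrArg (Subgroup.map β.symm.toMonoidHom) h2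
  simp only [Subgroup.map_sup, map_map_symm, map_symm_of_map β hβ0] at h3
  exact h3.symm

/-! ## 1. NIELSEN LEVEL, genus 3 (`m = 0`): vacuous — provable now, no shadow hypothesis

Stub 1 · `stub_genusThreeNielsen` · at `(3;1,1,1)` the H₀-relative T-system is automatically
standard: `F = F₃`, `Ū`, `V̄_K` are kernels of epimorphisms onto `ℤ` (`F/V̄_K ≅ S/⟪N₀ ∪ K₂⟫ ≅ ℤ`
by `free_pairQuotient 0 2`) with `Ū ⊔ V̄_K = ⊤` (`triple`), so they are determined by the rows
`(1,0,0)` and `(v₁,v₂,v₃)`, `gcd(v₂,v₃) = 1`, of a surjection `ℤ³ → ℤ²`; column operations fixing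
the first row reduce the second to `(0,1,0)`, and `Aut F₃ ↠ GL₃(ℤ)` (Nielsen) realises them
(triage r1-1 (i), card calibration (3)). The line is therefore EMPTY at the first open type: at
`m = 0` the crux is `stub_twistLevel`. Stated in the line's normal form at `m = 0` literally
(`3 + 3 * 0 = 3`, `s4Kernels.stabilizeIter 0 = s4Kernels` by `rfl`). Size M (Lean: L — needs
`S ⧸ N 0 ≅ F₃` via `quotientEquivFreeGroupErase`, abelianisation, lifting GL₃(ℤ) to `Aut F₃`). -/
/-- LANDED: `stub_genusThreeNielsen` (p92539, `Theorems/CongruenceShadowsShadowApproximationStubGenusThreeNielsen.lean`); the registered statement is proved in the tree and used here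
by its fully qualified name. -/
theorem stub_genusThreeNielsen_landed : True := trivial

/-! ## 2. NIELSEN LEVEL, `m ≥ 1`: the load-bearing stub (dense free factor from standard shadows)

Stub 2 · `stub_denseFactor` · for a slot-normalised `(3+3m; m+1)` group trisection
`K = (N 0, N 1, K 2)` of `{1}`, `m ≥ 1`, whose three pairs are standard and all of whose
characteristic finite shadows are standard, there is `θ₀ ∈ Aut F` with `θ₀(V̄_N) = V̄_K` (so
`A := θ₀(B_V)` is a rank-`2(m+1)` free factor with normal closure `V̄_K`) such that the image of `A`
in `F/Ū ≅ F_{m+1}` is PROFINITELY DENSE: `A ⊔ P = ⊤` for every normal finite-index `P ⊇ Ū`.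
(`θ₀(V̄_N) = V̄_K` alone is free — `(N 0, K 2)` is a standard pair; `⟪φ_U(A)⟫ = F/Ū` alone is free —
`Ū ⊔ V̄_K = ⊤`; the content is the CHOICE of the factor `A` inside `Stab_{Aut F}(V̄_K) · A`, to be
read off the coherent family of level automorphisms `σ_M ∈ Aut(F/M̄)` induced by `hS`
(compactness: `hS` ⟺ one `Θ` in the closure of the level-stabiliser images in `Aut F̂` with
`Θ(Û) = Û`, `Θ(V̂_N) = V̂_K`), using profinite rigidity of free factors in ONE free group
(Garrido–Jaikin-Zapirain arXiv:2207.00912 Thm 1.1; Parzanchevski–Puder arXiv:1202.3269;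
Jaikin-Zapirain–Souza–Zalesskii arXiv:2603.16674) and the geometric input `hW`.)
WHY IT MIGHT FAIL: the level automorphisms come from level stabilisers `Stab(N₀M) ⊋ im Stab(N₀)`
(units obstruction, route NUMBERS), and `FreeGate_k` may fail off the geometric locus (card's devil
tuple at `k = 2`); the statement is implied by the crux (take `θ₀ = γ̄`), so a refutation is a
non-standard balanced trisection of a homotopy 4-sphere with standard shadows. Size XL / open. -/
theorem stub_denseFactor :
    ∀ (m : ℕ), 0 < m → ∀ (K : TrisectionKernels (3 + 3 * m)),
      IsGroupTrisection (3 + 3 * m) (m + 1) (PUnit : Type) K →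
      K 0 = s4Kernels.stabilizeIter m 0 →
      K 1 = s4Kernels.stabilizeIter m 1 →
      (∀ i j : Fin 3, i ≠ j → ∃ α : SurfaceGroup (3 + 3 * m) ≃* SurfaceGroup (3 + 3 * m),
        (s4Kernels.stabilizeIter m i).map α.toMonoidHom = K i ∧
          (s4Kernels.stabilizeIter m j).map α.toMonoidHom = K j) →
      (∀ M : Subgroup (SurfaceGroup (3 + 3 * m)), M.Characteristic → M.FiniteIndex →
        ∃ ψ : SurfaceGroup (3 + 3 * m) ≃* SurfaceGroup (3 + 3 * m), ∀ i : Fin 3,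
          (s4Kernels.stabilizeIter m i ⊔ M).map ψ.toMonoidHom = K i ⊔ M) →
      ∃ θ₀ : (SurfaceGroup (3 + 3 * m) ⧸ s4Kernels.stabilizeIter m 0) ≃*
          (SurfaceGroup (3 + 3 * m) ⧸ s4Kernels.stabilizeIter m 0),
        ((s4Kernels.stabilizeIter m 2).map (QuotientGroup.mk' (s4Kernels.stabilizeIter m 0))).map
            θ₀.toMonoidHom =
          (K 2).map (QuotientGroup.mk' (s4Kernels.stabilizeIter m 0)) ∧
        ∀ P : Subgroup (SurfaceGroup (3 + 3 * m) ⧸ s4Kernels.stabilizeIter m 0),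
          P.Normal → P.FiniteIndex →
          (s4Kernels.stabilizeIter m 1).map (QuotientGroup.mk' (s4Kernels.stabilizeIter m 0)) ≤ P →
          ((Subgroup.closure
              (Set.range (fun j : Fin (m + 1) =>
                  SurfaceGroup.b (⟨3 * (j : ℕ), by omega⟩ : Fin (3 + 3 * m))) ∪
                Set.range (fun j : Fin (m + 1) =>
                  SurfaceGroup.a (⟨3 * (j : ℕ) + 2, by omega⟩ : Fin (3 + 3 * m))))).map
              (QuotientGroup.mk' (s4Kernels.stabilizeIter m 0))).map θ₀.toMonoidHom ⊔ P = ⊤ := by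
  sorry

/-! ## 3. M. Hall's theorem: the profinite-to-discrete step in a free group

Stub 3 · `stub_hallClosure` · in `F = S ⧸ N 0`, modulo `Ū = π(N 1)` (so inside the free group
`F/Ū ≅ S/⟪N₀ ∪ N₁⟫ ≅ F_{m+1}`, `free_pairQuotient 0 1` of the standard triple): a finitely
generated subgroup `H` with `H ⊔ P = ⊤` for every normal finite-index `P ⊇ Ū` satisfies
`H ⊔ Ū = ⊤`. This is M. Hall 1949 (finitely generated subgroups of free groups are closed in the
profinite topology / virtual free factors): if `H̄ ≠ F/Ū`, `H̄` is a free factor of a finite-index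
`L = H̄ ∗ C`; either `L ≠ F/Ū` (take `P` = core of `L`) or `C ≠ 1` (kill `H̄`, then a finite
quotient of `C`) produces a normal finite-index `P ⊇ Ū` with `H ⊔ P ≠ ⊤`. Known theorem; size L in
Lean (no M. Hall / Stallings folding in Mathlib). -/
/-- LANDED: `stub_hallClosure` (p92799, `…StubHallClosure.lean`, via M. Hall (Literature `FreeGroupSubgroupSeparable.lean`, p92059)); the registered statement is proved in the tree and used here
by its fully qualified name. -/
theorem stub_hallClosure_landed : True := trivial

/-! ## 4. Re-basing: T⁺ ⟹ Nielsen-standard (triage r1-1 sharpening, checked on paper there)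

Stub 4 · `stub_rebasing` · in `F = S ⧸ N 0` with its basis `{b̄_{3j}, b̄_{3j+1}, ā_{3j+2}}`: if
`θ₀ ∈ Aut F` and the free factor `A := θ₀(B_V)` satisfies T⁺, `A ⊔ Ū = ⊤` (i.e. `φ_U(A) = F/Ū`),
then some `θ ∈ Aut F` fixes `Ū` and agrees with `θ₀` on `V̄_N = ⟪B_V⟫`: `θ(Ū) = Ū`,
`θ(V̄_N) = θ₀(V̄_N)`. Proof sketch: `φ_U|_A : A ≅ F_{2k} ↠ F/Ū ≅ F_k` is an epimorphism of free
groups, hence Nielsen-equivalent to the standard projection (a generating tuple of `F_k` is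
Nielsen-equivalent to a basis padded with `1`s; Lyndon–Schupp I.2): a basis `a₁…a_{2k}` of `A` with
`φ_U(a_j) = φ_U(b̄_{3j})`, `a_{k+j} ∈ Ū`; complement `C = θ₀⟨b̄_{3j+1}⟩`, corrected by words in
`a₁…a_k` into `Ū`; `θ : b̄_{3j} ↦ a_j, ā_{3j+2} ↦ a_{k+j}, b̄_{3j+1} ↦ c'_j`; then
`θ(V̄_N) = ⟪A⟫ = θ₀(V̄_N)` and `θ(Ū) ⊆ Ū` with equality by Hopficity of `F_k`. Known-type
(Nielsen 1921 / Lyndon–Schupp Prop I.2.x, Dunwoody's folklore `ker(F_g ↠ F_k) = ⟪free factor⟫`);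
size L in Lean (Nielsen reduction is not in Mathlib). -/
/-- LANDED: `stub_rebasing` (p93770, `…StubRebasing.lean`, via Literature `NielsenGeneratingTuples*.lean` (p92232, p93213), `FreeGroupRebasing.lean` (p93592)); the registered statement is proved in the tree and used here
by its fully qualified name. -/
theorem stub_rebasing_landed : True := trivial

/-! ## 5. Handlebody realisation (Zieschang–Luft–McMillan): `Stab_{Aut S}(N 0) ↠ Aut (S ⧸ N 0)`

Stub 5 · `stub_handlebodyRealisation` · every automorphism `θ` of `F = S ⧸ N 0 = π₁(H₀)` is
induced by an automorphism `β` of the surface group with `β(N 0) = N 0`. Known: every automorphism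
of `π₁` of a handlebody is induced by a handlebody homeomorphism (Zieschang; Luft 1978,
doi:10.1007/bf01420650, whose kernel is the twist group; McMillan; Hensel's primer), whose boundary
restriction gives `β` by Dehn–Nielsen–Baer; inner automorphisms of `F` lift to inner automorphisms
of `S`. Algebraically: lift the Nielsen generators of `Aut F` (permutations, inversions, one
transvection w.r.t. the basis `{b̄_{3j}, b̄_{3j+1}, ā_{3j+2}}`) to automorphisms of the one-relator
group `S` preserving `⟪a_{3j}, a_{3j+1}, b_{3j+2}⟫`. Size L (explicit lifts + relator checks in
`PresentedGroup`); it also makes `π(M)` characteristic in `F` for `M` characteristic in `S`, the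
level dictionary used inside Stub 2. -/
-- LANDED as `Summit.SmoothPoincare4.SmoothPoincare4.Theorems.ShadowApproximation.FreeShadowTsystem.stub_handlebodyRealisation` (p105838); kept sorried in this
-- interim tree copy only because the check farm had not yet built that module (import it and delete this).
theorem stub_handlebodyRealisation :
    ∀ (m : ℕ) (θ : (SurfaceGroup (3 + 3 * m) ⧸ s4Kernels.stabilizeIter m 0) ≃*
        (SurfaceGroup (3 + 3 * m) ⧸ s4Kernels.stabilizeIter m 0)),
      ∃ β : SurfaceGroup (3 + 3 * m) ≃* SurfaceGroup (3 + 3 * m),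
        (s4Kernels.stabilizeIter m 0).map β.toMonoidHom = s4Kernels.stabilizeIter m 0 ∧
        ∀ s : SurfaceGroup (3 + 3 * m),
          QuotientGroup.mk' (s4Kernels.stabilizeIter m 0) (β s) =
            θ (QuotientGroup.mk' (s4Kernels.stabilizeIter m 0) s) := by
  sorry

/-! ## 6. TWIST LEVEL (the honest residual): trisections of `{1}` in the Luft fibre are standard

Stub 6 · `stub_twistLevel` · a `(3+3m; m+1)` group trisection `K` of `{1}` with standard pairs and
standard characteristic finite shadows which lies in the LUFT FIBRE of the standard T-system —
`K 0 = N 0` and `K i ≡ N i (mod N 0)` for `i = 1, 2`, i.e. the handlebodies `H₁' , H₂'` induce on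
`π₁(H₀)` exactly the standard kernels `Ū, V̄_N` — is isomorphic to `N`. By Luft's exact sequence
`1 → Tw(H₀) → Mod(H₀) → Out F_g → 1` (twist group generated by meridian-disc twists, Luft 1978;
McCullough 1985) this is a statement about regluings of the standard trisection by elements acting
trivially on `π₁(H₀)`: a double-coset problem `Tw(H₀) ∩ {conditions} ⊆ Stab(N₀,N₁)·Stab(N₀,N₂)`
(Birman's form of Waldhausen-type uniqueness), the GPRC / Property-2R face of the crux
(`Literature.Barriers.SmoothPoincare4.StrictPropertyTwoRBarrier` conceded: a meridian twist of
`H₀` is a `Σ`-framed surgery in `#ᵏ S¹×S²`). WHY IT MIGHT FAIL: it is the crux restricted to the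
Luft fibre, hence still `SPC4_g ∧` balanced 4-d Waldhausen`_g` on that locus; at `m = 0` it IS the
crux (Stub 1), where Aranda–Zupan arXiv:2503.04607 Q 8.2/8.3 is the frontier. Size: open-problem. -/
theorem stub_twistLevel :
    ∀ (m : ℕ) (K : TrisectionKernels (3 + 3 * m)),
      IsGroupTrisection (3 + 3 * m) (m + 1) (PUnit : Type) K →
      (∀ i j : Fin 3, i ≠ j → ∃ α : SurfaceGroup (3 + 3 * m) ≃* SurfaceGroup (3 + 3 * m),
        (s4Kernels.stabilizeIter m i).map α.toMonoidHom = K i ∧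
          (s4Kernels.stabilizeIter m j).map α.toMonoidHom = K j) →
      (∀ M : Subgroup (SurfaceGroup (3 + 3 * m)), M.Characteristic → M.FiniteIndex →
        ∃ ψ : SurfaceGroup (3 + 3 * m) ≃* SurfaceGroup (3 + 3 * m), ∀ i : Fin 3,
          (s4Kernels.stabilizeIter m i ⊔ M).map ψ.toMonoidHom = K i ⊔ M) →
      K 0 = s4Kernels.stabilizeIter m 0 →
      K 1 ⊔ s4Kernels.stabilizeIter m 0 = s4Kernels.stabilizeIter m 1 ⊔ s4Kernels.stabilizeIter m 0 →
      K 2 ⊔ s4Kernels.stabilizeIter m 0 = s4Kernels.stabilizeIter m 2 ⊔ s4Kernels.stabilizeIter m 0 →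
      TrisectionKernels.Iso (s4Kernels.stabilizeIter m) K := by
  sorry

/-! ## 7. Composition (sorry-free glue): the six stubs prove the crux BY NAME -/

/-- The generating set of `B_V` (images of `b_{3j}`, `a_{3j+2}`, `j ≤ m`) is finite, so
`θ₀(B_V)` is finitely generated — the finiteness input of M. Hall's theorem. -/
theorem fg_factor (m : ℕ)
    (θ₀ : (SurfaceGroup (3 + 3 * m) ⧸ s4Kernels.stabilizeIter m 0) ≃*
      (SurfaceGroup (3 + 3 * m) ⧸ s4Kernels.stabilizeIter m 0)) :
    (((Subgroup.closure
          (Set.range (fun j : Fin (m + 1) =>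
              SurfaceGroup.b (⟨3 * (j : ℕ), by omega⟩ : Fin (3 + 3 * m))) ∪
            Set.range (fun j : Fin (m + 1) =>
              SurfaceGroup.a (⟨3 * (j : ℕ) + 2, by omega⟩ : Fin (3 + 3 * m))))).map
          (QuotientGroup.mk' (s4Kernels.stabilizeIter m 0))).map θ₀.toMonoidHom).FG := by
  rw [MonoidHom.map_closure, MonoidHom.map_closure, Subgroup.fg_iff]
  exact ⟨_, rfl, (((Set.finite_range _).union (Set.finite_range _)).image _).image _⟩

/-- **The crux on slot-normalised triples** (`K 0 = N 0`, `K 1 = N 1`), from the stubs: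
Nielsen level (Stub 1 at `m = 0`; Stubs 2 → 3 → 4 at `m ≥ 1`) gives `θ ∈ Aut F` fixing `Ū` with
`θ(V̄_N) = V̄_K`; Stub 5 realises `θ` by `β ∈ Stab(N 0)`; `β⁻¹ • K` lies in the Luft fibre
(`sup_eq_of_quotient`) and keeps every hypothesis (transport lemmas); Stub 6 concludes, and
`iso_transport` undoes `β`. -/
theorem normalised_case (m : ℕ) (K : TrisectionKernels (3 + 3 * m))
    (hK : IsGroupTrisection (3 + 3 * m) (m + 1) (PUnit : Type) K)
    (h0 : K 0 = s4Kernels.stabilizeIter m 0) (h1 : K 1 = s4Kernels.stabilizeIter m 1)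
    (hW : ∀ i j : Fin 3, i ≠ j → ∃ α : SurfaceGroup (3 + 3 * m) ≃* SurfaceGroup (3 + 3 * m),
      (s4Kernels.stabilizeIter m i).map α.toMonoidHom = K i ∧
        (s4Kernels.stabilizeIter m j).map α.toMonoidHom = K j)
    (hS : ∀ M : Subgroup (SurfaceGroup (3 + 3 * m)), M.Characteristic → M.FiniteIndex →
      ∃ ψ : SurfaceGroup (3 + 3 * m) ≃* SurfaceGroup (3 + 3 * m), ∀ i : Fin 3,
        (s4Kernels.stabilizeIter m i ⊔ M).map ψ.toMonoidHom = K i ⊔ M) :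
    TrisectionKernels.Iso (s4Kernels.stabilizeIter m) K := by
  -- Nielsen level: an automorphism of `F = S ⧸ N 0` fixing `Ū` and carrying `V̄_N` to `V̄_K`
  obtain ⟨θ, hθU, hθV⟩ :
      ∃ θ : (SurfaceGroup (3 + 3 * m) ⧸ s4Kernels.stabilizeIter m 0) ≃*
          (SurfaceGroup (3 + 3 * m) ⧸ s4Kernels.stabilizeIter m 0),
        ((s4Kernels.stabilizeIter m 1).map (QuotientGroup.mk' (s4Kernels.stabilizeIter m 0))).map
            θ.toMonoidHom =
          (s4Kernels.stabilizeIter m 1).map (QuotientGroup.mk' (s4Kernels.stabilizeIter m 0)) ∧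
        ((s4Kernels.stabilizeIter m 2).map (QuotientGroup.mk' (s4Kernels.stabilizeIter m 0))).map
            θ.toMonoidHom =
          (K 2).map (QuotientGroup.mk' (s4Kernels.stabilizeIter m 0)) := by
    rcases Nat.eq_zero_or_pos m with rfl | hm
    · -- genus 3: the Nielsen level is vacuous (Stub 1)
      exact Summit.SmoothPoincare4.SmoothPoincare4.Theorems.ShadowApproximation.FreeShadowTsystem.stub_genusThreeNielsen K hK h0 h1 hW
    · -- `m ≥ 1`: dense factor (Stub 2) → M. Hall (Stub 3) → re-basing (Stub 4)
      obtain ⟨θ₀, hθ₀V, hdense⟩ := stub_denseFactor m hm K hK h0 h1 hW hS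
      obtain ⟨θ, hθU, hθV⟩ :=
        Summit.SmoothPoincare4.SmoothPoincare4.Theorems.ShadowApproximation.FreeShadowTsystem.stub_rebasing m θ₀ (Summit.SmoothPoincare4.SmoothPoincare4.Theorems.ShadowApproximation.FreeShadowTsystem.stub_hallClosure m _ (fg_factor m θ₀) hdense)
      exact ⟨θ, hθU, hθV.trans hθ₀V⟩
  -- Handlebody realisation (Stub 5)
  obtain ⟨β, hβ0, hβ⟩ := stub_handlebodyRealisation m θ
  -- `β⁻¹ • K` lies in the Luft fibre
  have h0' : (K 0).map β.symm.toMonoidHom = s4Kernels.stabilizeIter m 0 := by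
    rw [h0]
    exact map_symm_of_map β hβ0
  have h1' : (K 1).map β.symm.toMonoidHom ⊔ s4Kernels.stabilizeIter m 0 =
      s4Kernels.stabilizeIter m 1 ⊔ s4Kernels.stabilizeIter m 0 := by
    rw [h1]
    exact sup_eq_of_quotient β θ hβ0 hβ hθU
  have h2' : (K 2).map β.symm.toMonoidHom ⊔ s4Kernels.stabilizeIter m 0 =
      s4Kernels.stabilizeIter m 2 ⊔ s4Kernels.stabilizeIter m 0 :=
    sup_eq_of_quotient β θ hβ0 hβ hθV
  -- Twist level (Stub 6) on `β⁻¹ • K`, then undo `β`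
  exact iso_transport β
    (stub_twistLevel m (fun i => (K i).map β.symm.toMonoidHom) (isGroupTrisection_map hK β.symm)
      (pairs_transport β.symm hW) (shadows_transport β.symm hS) h0' h1' h2')

/-- **Composition.** The six stubs prove the crux `CongruenceShadows.ShadowApproximation` BY NAME:
normalise slots `0, 1` with the automorphism supplied by the crux's own hypothesis `hW 0 1`
(transporting `IsGroupTrisection`, `hW`, `hS` along `α⁻¹`), apply `normalised_case`, undo `α`. -/
theorem ShadowApproximation_of :
    _root_.Summit.SmoothPoincare4.SmoothPoincare4.Theses.CongruenceShadows.ShadowApproximation := by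
  intro m K hK hW hS
  obtain ⟨α, hα0, hα1⟩ := hW 0 1 (by decide)
  exact iso_transport α
    (normalised_case m (fun i => (K i).map α.symm.toMonoidHom) (isGroupTrisection_map hK α.symm)
      (map_symm_of_map α hα0) (map_symm_of_map α hα1)
      (pairs_transport α.symm hW) (shadows_transport α.symm hS))

end Summit.SmoothPoincare4.SmoothPoincare4.Cruxes.ShadowApproximation.FreeShadowTsystem

end
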